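import Literature.MathematicalPhysics.QuantumFieldTheory.Balaban1983to89.TreeLengthTorus

/-!
# `Balaban1983to89.B12Chain026Torus` — T. Bałaban, *Renormalization group approach to lattice gauge field theories.
I. Generation of effective actions in a small field approximation and a coupling constant renormalization in four
dimensions*, Commun. Math. Phys. **109** (1987) 249–301 [Balaban1987RG1]: the two ultraviolet-stability chains
(0.26) p. 257 and (0.30) p. 258 AS PRINTED, on the paper's own periodic carrier (the torus cube system of
`…TreeLengthTorus`, d = 4), with the two silent geometric inputs DISCHARGED — only the displayed inputs (0.25),
resp. (0.29), remain

statement-level skeleton of published theorems with citation tags; proofs where landed; nothing here is a claim about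
the Yang–Mills mass gap

PDF held: `paper:balaban1987-cmp109-rg-i-small-field` (journal page = PDF page + 248); p. 257 [PDF 9] and p. 258
[PDF 10] re-read on the text layer (`lit read … --pages 9-10`) for this module; the displays are quoted verbatim in the
docstrings of `B12.Chain026Printed` / `B12.Chain030Printed` (module `…Balaban1983to89.B12`), repeated below.

CITATION HEADER / WHAT IS REPRODUCED (unit `lit-balaban-r20` gen 6, B12 fold owner; SKELETON rows **`B12.Eq0.26`** and
**`B12.Eq0.30`** (owner rows r20-B12-E1, second-read r12 g6 VERIFIED-render); HOME
`run/shared/lean/pub/lit-balaban/`, owner file `lit-balaban-r20/ROWS-B12.md`):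

p. 257 [PDF 9], verbatim: *"Let us study implications of the inequality (0.25). We obtain
  |Σ_{j=1}^{k} 𝐄^{(j)}(U_k)| ≦ Σ_{j=1}^{k} Σ_{X∈𝐃_j} E₀ exp(−κd_j(X)) ≦ Σ_{j=1}^{k} Σ_{□∈π_j} Σ_{X∈𝐃_j,X⊃□} E₀ exp(−κd_j(X))
   ≦ Σ_{j=1}^{k} Σ_{□∈π_j} E₀O(1) = Σ_{j=1}^{k} E₀O(1)M^{−4}|T_1^{(j)}| ≦ E₀O(1)M^{−4}|T_1^{(k)}|η^{−4},  η = L^{−k}.  (0.26)"*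

p. 258 [PDF 10], verbatim: *"These inequalities yield a uniform bound of the sum (0.23) on the lattice T_η, i.e. the
only dependence on k is through the volume |T_η| = |T_1^{(k)}| corresponding to the scale η. Indeed, we have
  |𝐄_k(U_k)| ≦ Σ_{j=1}^{k} Σ_{X∈𝐃_j} O(1)(L^jη)^{4+α} exp(−κd_j(X)) ≦ Σ_{j=1}^{k} Σ_{□∈π_j} Σ_{X∈𝐃_j,X⊃□} O(1)(L^jη)^{4+α}
   exp(−κd_j(X)) ≦ Σ_{j=1}^{k} Σ_{□∈π_j} O(1)(L^jη)^{4+α} = Σ_{j=1}^{k} O(1)(L^jη)^α M^{−4}|T_1^{(k)}|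
   ≦ O(1)(1 − L^{−α})^{−1} M^{−4}|T_1^{(k)}|.  (0.30)"*; p. 259 [PDF 11]: *"This is the essence of the ultraviolet
stability concept"*.

THE CARRIER (p. 257 [PDF 9], verbatim): *"We decompose the space T into the lattice of closed cubes of a size M, where
M = L^m, with centers at points of the lattice T_M^{(j+m)}. … We denote this family of cubes by π_j"*, T the TORUS of
p. 251 — in the tree the periodic index model `TreeLengthTorus.tsys d N` (the localization domains 𝐃_j of a torus with
`N` cubes of π_j per direction, `d_j` = `torusTreeLen`) with its cube system `tcubeSys d N` (b2b-balaban unit pv22).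
Across the scales `j ≤ k` of ONE lattice T_η the torus is the same physical torus, so π_j has `L^{k−j}·n` cubes per
direction when π_k has `n` (`ncubes`), and the unit lattice T_1^{(j)} has `(M·L^{k−j}·n)⁴` sites (`nsites`) — this is
the printed pair of identities `|π_j| = M^{−4}|T_1^{(j)}|`, `|T_1^{(j)}| = L^{4(k−j)}|T_1^{(k)}|` used between the third
and the last members of both chains.

WHAT THIS MODULE DOES (imports `…TreeLengthTorus` only; modifies nothing; 0 sorry; no new `def … : Prop`):
1. `ncubes`, `nsites` (the torus family across scales, two `ℕ`/`ℝ`-valued bookkeeping definitions with bodies) and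
   the two printed count identities `nsites_scale` (|T_1^{(j)}| = L^{4(k−j)}|T_1^{(k)}|), `card_cubes_torus`
   (|π_j| = M^{−4}|T_1^{(j)}|).
2. **`chain026Printed_torus`** — (0.26) AS PRINTED (`B12.Chain026Printed`, END MEMBERS) for the torus localization
   domains of every scale `1 ≤ j ≤ k`, from the displayed input (0.25) (`B12.Bound025Printed`) ALONE: the silent
   input (a) «Σ_{X∈𝐃_j, X⊃□} exp(−κd_j(X)) ≦ O(1)» is `TreeLengthTorus.hTree_scales_torus` (PROVED there for
   κ ≥ κ₀(64, 8), O(1) = K₀(64, 8) of `B12TreeDecay`), the silent input (b) is item 1; the printed O(1) of (0.26) is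
   K₀(64, 8); `L ≥ 2` (print: *"L is an odd, positive integer > 11"*, p. 251).
3. **`chain030Printed_torus`** — (0.30) AS PRINTED (`B12.Chain030Printed`, END MEMBERS) for the same carrier, from
   the displayed input (0.29) (`B12.Bound029Printed`, one O(1), α > 0, κ for all j) and (0.23)+(0.28) in the form
   `𝐄_k(U_k) = Σ_{j=1}^{k} Σ_{X∈𝐃_j} 𝐕^{(j)}(X,U_k)` ALONE; the printed final O(1) is `O1·K₀(64, 8)`.
4. `chain026Printed_params` / `chain030Printed_params` — the same two statements read on the lattices (0.1) of
   `Setup.Params` (sites per direction `2L^{m+K−j}` = `Params.sitesPerDir`, cubes of side `M = L^{m_M}`, `m_M ≤ m`,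
   `paramsCubes P m_M k = 2L^{m+K−k−m_M}` cubes of `π_k` per direction; `sitesPerDir_eq_M_mul`,
   `paramsCubes_eq_ncubes`, `nsites_params`): |T_1^{(k)}| = `(P.sitesPerDir k)⁴`.
Everything is a composition BY NAME of `B12.chain026Printed_of` / `B12.chain030Printed_of` (b2b-balaban surge node
T09.1, the kernel-checked chains with `hTree`, `hπ`, `hSites` as hypotheses) with `TreeLengthTorus.hTree_scales_torus`
and `TreeLengthTorus.card_tcube_eq_inv_pow`; the family-level statement `TreeLengthTorus.uvStable030_of_thm1_torus`
(Theorem 1 ⇒ `B12.UVStable030`) already existed — what is added here is the DISPLAY level: the two rows' printed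
chains on the printed carrier with no geometric hypothesis left.

WHAT IS *NOT* HERE: the inputs (0.25)/(0.29) themselves for Bałaban's expansion (they are the inductive assumption
(1.18) and the content of Theorem 3 / §§2–5 + [Balaban1988RG2Cluster] — hypotheses here, exactly as in print: *"Let
us study implications of the inequality (0.25)"*); the intermediate members of the chains as separate displays (they
are inside `B12.chain026_holds` / `chain030_holds`); any value of κ₀ smaller than the tree's `kappa₀ 64 8 = 64·log 162`
(the Summits-side `UVStable030TorusChain` has κ ≥ 144 with another constant; not imported into Literature).
Value = two printed displays of [I] closed on the paper's carrier modulo their displayed inputs; NOT summit progress.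
-/

noncomputable section

open scoped BigOperators

namespace Literature.MathematicalPhysics.QuantumFieldTheory.Balaban1983to89.B12Chain026Torus

open Literature.MathematicalPhysics.QuantumFieldTheory.Balaban1983to89
open Literature.MathematicalPhysics.QuantumFieldTheory.Balaban1983to89.B12TreeDecay
open Literature.MathematicalPhysics.QuantumFieldTheory.Balaban1983to89.TreeLengthTorus

/-! ## 1. The torus family across the scales `j ≤ k` and the two printed counts -/

/-- Cubes of `π_j` per direction of the torus when `π_k` has `n` per direction: `L^{k−j}·n` (p. 257 [9]: cubes *"of
a size M … with centers at points of the lattice T_M^{(j+m)}"* on the fixed torus T of p. 251, so the count scales by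
`L` per step). [cite: Balaban1987RG1, §0 p.257] -/
def ncubes (L n k j : ℕ) : ℕ := L ^ (k - j) * n

/-- `ncubes` is never zero for `L, n ≠ 0` (the torus is nonempty). [cite: Balaban1987RG1, §0 p.257] -/
instance instNeZeroNcubes (L n k j : ℕ) [NeZero L] [NeZero n] : NeZero (ncubes L n k j) :=
  ⟨mul_ne_zero (pow_ne_zero _ (NeZero.ne L)) (NeZero.ne n)⟩

/-- At the top scale `j = k` the count is `n`. [cite: Balaban1987RG1, §0 p.257] -/
@[simp] theorem ncubes_self (L n k : ℕ) : ncubes L n k k = n := by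
  simp [ncubes]

/-- `|T_1^{(j)}|` = the number of sites of the unit lattice of scale `j` = `(M · ncubes)⁴` in d = 4 (each cube of
`π_j` has `M⁴` unit-lattice sites; (0.26) p. 257: *"Σ_{□∈π_j} E₀O(1) = … E₀O(1)M^{−4}|T_1^{(j)}|"*). [cite: Balaban1987RG1, (0.26) p.257] -/
def nsites (M : ℝ) (L n k j : ℕ) : ℝ := (M * (ncubes L n k j : ℝ)) ^ 4

/-- `|T_1^{(j)}| ≥ 0` (a fourth power). [cite: Balaban1987RG1, (0.26) p.257] -/
theorem nsites_nonneg (M : ℝ) (L n k j : ℕ) : 0 ≤ nsites M L n k j := by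
  unfold nsites; positivity

/-- The printed site count between the fourth and fifth members of (0.26): `|T_1^{(j)}| = L^{4(k−j)}|T_1^{(k)}|`
(p. 257: *"= Σ_{j=1}^{k} E₀O(1)M^{−4}|T_1^{(j)}| ≦ E₀O(1)M^{−4}|T_1^{(k)}|η^{−4}, η = L^{−k}"*). [cite: Balaban1987RG1, (0.26) p.257] -/
theorem nsites_scale (M : ℝ) (L n k j : ℕ) :
    nsites M L n k j = ((L : ℝ) ^ (k - j)) ^ 4 * nsites M L n k k := by
  unfold nsites
  rw [ncubes_self]
  unfold ncubes
  push_cast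
  ring

/-- The printed cube count of the third-to-fourth member of (0.26)/(0.30): `|π_j| = M^{−4}|T_1^{(j)}|` for the torus
cube system (`TreeLengthTorus.card_tcube_eq_inv_pow`). [cite: Balaban1987RG1, (0.26) p.257] -/
theorem card_cubes_torus {M : ℝ} (hM : M ≠ 0) (L n k j : ℕ) [NeZero L] [NeZero n] :
    (Fintype.card (tcubeSys 4 (ncubes L n k j)).toCubeCover.Cube : ℝ) = M⁻¹ ^ 4 * nsites M L n k j :=
  card_tcube_eq_inv_pow 4 (ncubes L n k j) hM

/-! ## 2. (0.26) AS PRINTED on the torus, from (0.25) alone -/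

/-- **(0.26) p. 257, AS PRINTED, ON THE PAPER'S PERIODIC CARRIER** (`B12.Chain026Printed`, end members
`|Σ_{j=1}^{k} 𝐄^{(j)}(U_k)| ≦ E₀O(1)M^{−4}|T_1^{(k)}|η^{−4}`, η = L^{−k}, with O(1) = `K₀(64, 8)`): for the torus
localization domains `𝐃_j = tsys 4 (ncubes L n k j)` of every scale `1 ≤ j ≤ k`, terms `t j X = 𝐄^{(j)}(X, U_k)`
obeying the displayed input (0.25) `|𝐄^{(j)}(X,U_k)| ≦ E₀ exp(−κd_j(X))` with `E₀ ≥ 0` and `κ ≥ κ₀(64, 8)`, cube size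
`M > 0`, `L ≥ 2`.  NO geometric hypothesis: the tree-decay sums (silent input) are `TreeLengthTorus.hTree_scales_torus`,
the counts are `card_cubes_torus` / `nsites_scale`; composition with `B12.chain026Printed_of`. [cite: Balaban1987RG1, (0.26) p.257] -/
theorem chain026Printed_torus (L n k : ℕ) [NeZero L] [NeZero n] {M E₀ κ : ℝ} (hM : 0 < M) (hE₀ : 0 ≤ E₀)
    (hL : 2 ≤ L) (hκ : kappa₀ (4 * 2 ^ 4) (2 * 4) ≤ κ)
    (t : (j : ℕ) → (tsys 4 (ncubes L n k j)).Dom → ℝ)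
    (h025 : ∀ j ∈ Finset.Icc 1 k, B12.Bound025Printed (t j) E₀ κ) :
    B12.Chain026Printed (fun j => ∑ X, t j X) E₀ (K₀ (4 * 2 ^ 4) (2 * 4)) M (L : ℝ) (nsites M L n k k) k := by
  have hL4 : (2 : ℝ) ≤ (L : ℝ) ^ 4 := by
    have h2 : (2 : ℝ) ≤ (L : ℝ) := by exact_mod_cast hL
    calc (2 : ℝ) ≤ 2 ^ 4 := by norm_num
      _ ≤ (L : ℝ) ^ 4 := by gcongr
  exact B12.chain026Printed_of k (fun j => tsys 4 (ncubes L n k j))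
    (fun j => (tcubeSys 4 (ncubes L n k j)).toCubeCover) t E₀ κ (K₀ (4 * 2 ^ 4) (2 * 4)) M (L : ℝ)
    (nsites M L n k) hE₀ (K₀_pos _ _).le hM hL4 (nsites_nonneg M L n k k) h025
    (hTree_scales_torus 4 k (ncubes L n k) hκ)
    (fun j _ => card_cubes_torus hM.ne' L n k j)
    (fun j _ => nsites_scale M L n k j)

/-! ## 3. (0.30) AS PRINTED on the torus, from (0.29) alone -/

/-- **(0.30) p. 258, AS PRINTED, ON THE PAPER'S PERIODIC CARRIER** (`B12.Chain030Printed`, end members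
`|𝐄_k(U_k)| ≦ O(1)(1 − L^{−α})^{−1}M^{−4}|T_1^{(k)}|`, final O(1) = `O1·K₀(64, 8)`): for the torus localization domains
of every scale `1 ≤ j ≤ k`, irrelevant terms `v j X = 𝐕^{(j)}(X, U_k)` obeying the displayed input (0.29)
`|𝐕^{(j)}(X,U_k)| ≦ O(1)(L^jη)^{4+α} exp(−κd_j(X))` with ONE `O1 ≥ 0`, `α > 0` and `κ ≥ κ₀(64, 8)` for all `j`
(`η = L^{−k}`), and `𝐄_k(U_k) = Σ_{j=1}^{k} Σ_{X∈𝐃_j} 𝐕^{(j)}(X, U_k)` ((0.23) with (0.28) inserted); `M > 0`, `L ≥ 2`.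
NO geometric hypothesis; composition of `B12.chain030Printed_of` with `TreeLengthTorus.hTree_scales_torus` and the
counts of §1.  p. 259: *"the above bound is uniform in the lattice spacing ε. This is the essence of the ultraviolet
stability concept"* — the right member depends on `k` only through `|T_1^{(k)}|`. [cite: Balaban1987RG1, (0.30) p.258] -/
theorem chain030Printed_torus (L n k : ℕ) [NeZero L] [NeZero n] {M O1 α κ : ℝ} (Ek : ℝ) (hM : 0 < M)
    (hO1 : 0 ≤ O1) (hα : 0 < α) (hL : 2 ≤ L) (hκ : kappa₀ (4 * 2 ^ 4) (2 * 4) ≤ κ)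
    (v : (j : ℕ) → (tsys 4 (ncubes L n k j)).Dom → ℝ)
    (hEk : Ek = ∑ j ∈ Finset.Icc 1 k, ∑ X, v j X)
    (h029 : ∀ j ∈ Finset.Icc 1 k, B12.Bound029Printed (v j) O1 (L : ℝ) (((L : ℝ) ^ k)⁻¹) α κ j) :
    B12.Chain030Printed Ek (O1 * K₀ (4 * 2 ^ 4) (2 * 4)) (L : ℝ) α M (nsites M L n k k) := by
  have hL1 : (1 : ℝ) < (L : ℝ) := by exact_mod_cast (lt_of_lt_of_le one_lt_two hL)
  exact B12.chain030Printed_of k (fun j => tsys 4 (ncubes L n k j))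
    (fun j => (tcubeSys 4 (ncubes L n k j)).toCubeCover) v Ek O1 α κ (K₀ (4 * 2 ^ 4) (2 * 4)) M (L : ℝ)
    (nsites M L n k) hO1 hα (K₀_pos _ _).le hM hL1 (nsites_nonneg M L n k k) hEk h029
    (hTree_scales_torus 4 k (ncubes L n k) hκ)
    (fun j _ => card_cubes_torus hM.ne' L n k j)
    (fun j _ => nsites_scale M L n k j)

/-! ## 4. The same two statements read on the lattices (0.1) of `Setup.Params` -/

/-- `L ≠ 0` for the parameters of `Setup` (p. 251: *"L is an odd, positive integer > 11"*; `Params.hL`). [cite: Balaban1987RG1, (0.1) p.251] -/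
instance instNeZeroParamsL (P : Params) : NeZero P.L := ⟨P.L_pos.ne'⟩

/-- On the lattices (0.1) of `Setup.Params` (`P.sitesPerDir j = 2·L^{m+K−j}` sites of T^{(j)} per direction, p. 251)
with cubes of side `M = L^{m_M}` (p. 257 *"M = L^m"*; the cube exponent is written `m_M` here because `Params.m` is the
torus exponent of p. 251): the number of cubes of `π_k` per direction, `2·L^{m+K−k−m_M}`. [cite: Balaban1987RG1, §0 p.257] -/
def paramsCubes (P : Params) (mM k : ℕ) : ℕ := 2 * P.L ^ (P.m + P.K - k - mM)

/-- `paramsCubes` is never zero. [cite: Balaban1987RG1, §0 p.257] -/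
instance instNeZeroParamsCubes (P : Params) (mM k : ℕ) : NeZero (paramsCubes P mM k) :=
  ⟨mul_ne_zero two_ne_zero (pow_ne_zero _ P.L_pos.ne')⟩

/-- `M · (2·L^{m+K−j−m_M}) = P.sitesPerDir j` for `m_M ≤ m`, `j ≤ K`: the cubes of side `M = L^{m_M}` tile the
lattice T^{(j)} of (0.1). [cite: Balaban1987RG1, (0.1) p.251] -/
theorem sitesPerDir_eq_M_mul (P : Params) {mM j : ℕ} (hmM : mM ≤ P.m) (hj : j ≤ P.K) :
    ((P.sitesPerDir j : ℕ) : ℝ) = ((P.L : ℝ) ^ mM) * (paramsCubes P mM j : ℝ) := by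
  obtain ⟨r, hr, hr'⟩ : ∃ r, P.m + P.K - j = mM + r ∧ P.m + P.K - j - mM = r :=
    ⟨P.m + P.K - j - mM, by omega, rfl⟩
  unfold Params.sitesPerDir paramsCubes
  rw [hr', hr, pow_add]
  push_cast
  ring

/-- For the `Setup.Params` lattices at scales `j ≤ k ≤ K`: the cube count of scale `j` is `L^{k−j}` times that of
scale `k`, i.e. `paramsCubes P m_M j = ncubes L (paramsCubes P m_M k) k j` (`m_M ≤ m`). [cite: Balaban1987RG1, (0.1) p.251] -/
theorem paramsCubes_eq_ncubes (P : Params) {mM j k : ℕ} (hmM : mM ≤ P.m) (hjk : j ≤ k) (hk : k ≤ P.K) :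
    paramsCubes P mM j = ncubes P.L (paramsCubes P mM k) k j := by
  obtain ⟨r, hr, hr'⟩ : ∃ r, P.m + P.K - j - mM = (k - j) + r ∧ P.m + P.K - k - mM = r :=
    ⟨P.m + P.K - k - mM, by omega, rfl⟩
  unfold paramsCubes ncubes
  rw [hr, hr', pow_add]
  ring

/-- `|T_1^{(k)}| = (P.sitesPerDir k)⁴` is the `nsites` of the torus family with `paramsCubes P m_M k` cubes of `π_k`
per direction and `M = L^{m_M}` (`m_M ≤ m`, `k ≤ K`). [cite: Balaban1987RG1, (0.1) p.251] -/
theorem nsites_params (P : Params) {mM k : ℕ} (hmM : mM ≤ P.m) (hk : k ≤ P.K) :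
    nsites ((P.L : ℝ) ^ mM) P.L (paramsCubes P mM k) k k = ((P.sitesPerDir k : ℕ) : ℝ) ^ 4 := by
  unfold nsites
  rw [ncubes_self, sitesPerDir_eq_M_mul P hmM hk]

/-- **(0.26) on the lattices (0.1) of `Setup.Params`** (d = 4 reading of the counts: `|T_1^{(k)}| = (P.sitesPerDir k)⁴`,
cubes of side `M = L^{m_M}`, `m_M ≤ m`, scales `1 ≤ j ≤ k ≤ K`, localization domains of scale `j` = the torus system
with `ncubes L (paramsCubes P m_M k) k j = paramsCubes P m_M j` cubes per direction): from (0.25) alone, with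
O(1) = `K₀(64, 8)` and `κ ≥ κ₀(64, 8)`.  `chain026Printed_torus` specialised; `L ≥ 2` from `Params.hL`. [cite: Balaban1987RG1, (0.26) p.257] -/
theorem chain026Printed_params (P : Params) {mM k : ℕ} (hmM : mM ≤ P.m) (hk : k ≤ P.K) {E₀ κ : ℝ}
    (hE₀ : 0 ≤ E₀) (hκ : kappa₀ (4 * 2 ^ 4) (2 * 4) ≤ κ)
    (t : (j : ℕ) → (tsys 4 (ncubes P.L (paramsCubes P mM k) k j)).Dom → ℝ)
    (h025 : ∀ j ∈ Finset.Icc 1 k, B12.Bound025Printed (t j) E₀ κ) :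
    B12.Chain026Printed (fun j => ∑ X, t j X) E₀ (K₀ (4 * 2 ^ 4) (2 * 4)) ((P.L : ℝ) ^ mM) (P.L : ℝ)
      (((P.sitesPerDir k : ℕ) : ℝ) ^ 4) k := by
  have hM : (0 : ℝ) < (P.L : ℝ) ^ mM := by
    have : (0 : ℝ) < (P.L : ℝ) := by exact_mod_cast P.L_pos
    positivity
  rw [← nsites_params P hmM hk]
  exact chain026Printed_torus P.L (paramsCubes P mM k) k hM hE₀ P.hL.2 hκ t h025

/-- **(0.30) on the lattices (0.1) of `Setup.Params`** (same reading): from (0.29) and (0.23)+(0.28) alone, final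
O(1) = `O1·K₀(64, 8)`, `κ ≥ κ₀(64, 8)`; `η = L^{−k}`. [cite: Balaban1987RG1, (0.30) p.258] -/
theorem chain030Printed_params (P : Params) {mM k : ℕ} (hmM : mM ≤ P.m) (hk : k ≤ P.K) {O1 α κ : ℝ} (Ek : ℝ)
    (hO1 : 0 ≤ O1) (hα : 0 < α) (hκ : kappa₀ (4 * 2 ^ 4) (2 * 4) ≤ κ)
    (v : (j : ℕ) → (tsys 4 (ncubes P.L (paramsCubes P mM k) k j)).Dom → ℝ)
    (hEk : Ek = ∑ j ∈ Finset.Icc 1 k, ∑ X, v j X)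
    (h029 : ∀ j ∈ Finset.Icc 1 k, B12.Bound029Printed (v j) O1 (P.L : ℝ) (((P.L : ℝ) ^ k)⁻¹) α κ j) :
    B12.Chain030Printed Ek (O1 * K₀ (4 * 2 ^ 4) (2 * 4)) (P.L : ℝ) α ((P.L : ℝ) ^ mM)
      (((P.sitesPerDir k : ℕ) : ℝ) ^ 4) := by
  have hM : (0 : ℝ) < (P.L : ℝ) ^ mM := by
    have : (0 : ℝ) < (P.L : ℝ) := by exact_mod_cast P.L_pos
    positivity
  rw [← nsites_params P hmM hk]
  exact chain030Printed_torus P.L (paramsCubes P mM k) k Ek hM hO1 hα P.hL.2 hκ v hEk h029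

end Literature.MathematicalPhysics.QuantumFieldTheory.Balaban1983to89.B12Chain026Torus

end
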